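import Literature.Analysis.FluidPDE.TaoCascadeReducedClaimAssembly
import Literature.Analysis.FluidPDE.TaoCascadeScaleOneRegime
import Mathlib.Analysis.SpecialFunctions.Exp
import HarnessLib

/-!
# Tao's cascade ODE, §6.6: Prop. 6.13 holds in the regime (`SmallScaleOneInput`)

T. Tao, *Finite time blowup for an averaged three-dimensional Navier–Stokes equation*,
J. Amer. Math. Soc. 29 (2016), 601–674 = arXiv:1402.0290v3, §6.6 Prop. 6.13 ("(and take `K`
sufficiently large, `ε` sufficiently small, and `n₀` sufficiently large)").

`RescaledHypotheses.prop613_regime` / `prop613_d_one_lt` (`TaoCascadeScaleOneRegime.lean`) give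
Prop. 6.13 in closed form under explicit parameter inequalities, each of the type "`K` large
depending on `ε₀, C₃`" (`hκ, hKa, hKc, hKd, hKe`, the `K`-half of `hKf`) or "`n₀` large depending on
`ε₀, K, ε, C₁, C₃`" (`hδ1, hδ2`, the `n₀`-half of `hKf`, and the absorption of (6.118) into
`-½(1+ε₀)^{-n₀/4}`), plus `ε ≤ 1`. This file verifies that each inequality indeed holds eventually in
that sense (elementary asymptotics: `K⁻¹⁴ → 0`, `K^{-1/4} → 0`, `x e^{-x} → 0`, `x¹⁵ e^{-x} → 0`,
`e^{0.44 K¹⁰} ≥ 1 + 0.44 K¹⁰`, `(1+ε₀)^{-n₀/4} → 0`) and assembles, with the `InRegime` calculus of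
`TaoCascadeRescaledRegime.lean`, the regime statement `SmallScaleOneInput` of
`TaoCascadeReducedClaimAssembly.lean` (`smallScaleOneInput_holds`). Consequently the corrected
Prop. 6.5 is reduced to Prop. 6.15 alone:
`rescaledStepCorrected'_of_reducedClaimIIInput : ReducedClaimIIInput → rescaledStepCorrected'`.
Theorems only.

## References

* T. Tao, J. Amer. Math. Soc. 29 (2016), 601–674 = arXiv:1402.0290v3, §6.6 Prop. 6.13.
  [`Tao2016AveragedNS`]
-/

noncomputable section

open Set MeasureTheory intervalIntegral Filter
open scoped _root_.Topology

namespace Literature.Analysis.FluidPDE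

namespace TaoCascade

open Literature.Analysis.ODE

/-! ## Elementary asymptotics in `K` -/

section Asymptotics

/-- `A · K · (K¹⁵)⁻¹ · B ≤ 1` for `K` large (`A, B` fixed). [folklore] -/
theorem eventually_mul_K_mul_inv_pow_fifteen_le (A B : ℝ) :
    ∀ᶠ K : ℝ in atTop, A * K * ((K ^ 15)⁻¹ * B) ≤ 1 := by
  have h : Tendsto (fun K : ℝ => A * B * (K ^ 14)⁻¹) atTop (𝓝 (A * B * 0)) :=
    (tendsto_inv_atTop_zero.comp (tendsto_pow_atTop (by norm_num : (14 : ℕ) ≠ 0))).const_mul _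
  rw [mul_zero] at h
  filter_upwards [eventually_gt_atTop 0, h.eventually_le_const one_pos] with K hK hle
  have e : A * K * ((K ^ 15)⁻¹ * B) = A * B * (K ^ 14)⁻¹ := by
    field_simp
  rw [e]; exact hle

/-- `A (K³⁰)⁻¹ ≤ K^{-1/4}` for `K` large (`A` fixed). [folklore] -/
theorem eventually_mul_inv_pow_thirty_le_rpow (A : ℝ) :
    ∀ᶠ K : ℝ in atTop, A * (K ^ 30)⁻¹ ≤ K ^ (-(1 : ℝ) / 4) := by
  filter_upwards [eventually_ge_atTop 1,
    (tendsto_pow_atTop (by norm_num : (29 : ℕ) ≠ 0)).eventually_ge_atTop A] with K hK hA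
  have hK0 : 0 < K := by linarith
  have h1 : A * (K ^ 30)⁻¹ ≤ K⁻¹ := by
    rw [show K ^ 30 = K ^ 29 * K by ring, mul_inv, ← mul_assoc]
    have : A * (K ^ 29)⁻¹ ≤ 1 := by
      rw [← div_eq_mul_inv, div_le_one (by positivity)]; exact hA
    calc A * (K ^ 29)⁻¹ * K⁻¹ ≤ 1 * K⁻¹ := mul_le_mul_of_nonneg_right this (by positivity)
      _ = K⁻¹ := one_mul _
  have h2 : K⁻¹ ≤ K ^ (-(1 : ℝ) / 4) := by
    rw [← Real.rpow_neg_one]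
    exact Real.rpow_le_rpow_of_exponent_le hK (by norm_num)
  exact h1.trans h2

/-- `A K¹⁰ e^{-(188/100)K¹⁰} K^{-1/4} ≤ 1` for `K` large (`A` fixed; `x e^{-x} → 0`). [folklore] -/
theorem eventually_pow_ten_mul_exp_neg_le (A : ℝ) :
    ∀ᶠ K : ℝ in atTop, A * K ^ 10 * Real.exp (-(188 / 100) * K ^ 10) * K ^ (-(1 : ℝ) / 4) ≤ 1 := by
  have h : Tendsto (fun K : ℝ => |A| * ((K ^ 10) ^ 1 * Real.exp (-(K ^ 10)))) atTop
      (𝓝 (|A| * 0)) :=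
    ((Real.tendsto_pow_mul_exp_neg_atTop_nhds_zero 1).comp
      (tendsto_pow_atTop (by norm_num : (10 : ℕ) ≠ 0))).const_mul _
  rw [mul_zero] at h
  filter_upwards [eventually_ge_atTop 1, h.eventually_le_const one_pos] with K hK hle
  have hK0 : 0 < K := by linarith
  have hx : K ^ (-(1 : ℝ) / 4) ≤ 1 := Real.rpow_le_one_of_one_le_of_nonpos hK (by norm_num)
  have hx0 : 0 ≤ K ^ (-(1 : ℝ) / 4) := by positivity
  have hexp : Real.exp (-(188 / 100) * K ^ 10) ≤ Real.exp (-(K ^ 10)) :=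
    Real.exp_le_exp.2 (by nlinarith [pow_nonneg hK0.le 10])
  have hu : 0 ≤ K ^ 10 := by positivity
  calc A * K ^ 10 * Real.exp (-(188 / 100) * K ^ 10) * K ^ (-(1 : ℝ) / 4)
      ≤ |A| * K ^ 10 * Real.exp (-(188 / 100) * K ^ 10) * K ^ (-(1 : ℝ) / 4) := by
        have : 0 ≤ K ^ 10 * Real.exp (-(188 / 100) * K ^ 10) * K ^ (-(1 : ℝ) / 4) := by positivity
        nlinarith [le_abs_self A]
    _ ≤ |A| * K ^ 10 * Real.exp (-(K ^ 10)) * 1 := by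
        apply mul_le_mul _ hx hx0 (by positivity)
        exact mul_le_mul_of_nonneg_left hexp (by positivity)
    _ = |A| * ((K ^ 10) ^ 1 * Real.exp (-(K ^ 10))) := by ring
    _ ≤ 1 := hle

/-- `K^{-1/4} · A < 1/100` for `K` large (`A` fixed). [folklore] -/
theorem eventually_rpow_neg_quarter_mul_lt (A : ℝ) :
    ∀ᶠ K : ℝ in atTop, K ^ (-(1 : ℝ) / 4) * A < 1 / 100 := by
  have h : Tendsto (fun K : ℝ => K ^ (-((1 : ℝ) / 4))) atTop (𝓝 0) :=
    tendsto_rpow_neg_atTop (by norm_num)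
  have h' : Tendsto (fun K : ℝ => K ^ (-(1 : ℝ) / 4) * A) atTop (𝓝 (0 * A)) :=
    (h.congr fun K => by norm_num).mul_const A
  rw [zero_mul] at h'
  exact h'.eventually_lt_const (by norm_num)

/-- `e^{A (K¹⁴)⁻¹} ≤ 2` for `K` large (`A` fixed). [folklore] -/
theorem eventually_exp_mul_inv_pow_le_two (A : ℝ) :
    ∀ᶠ K : ℝ in atTop, Real.exp (A * (K ^ 14)⁻¹) ≤ 2 := by
  have h : Tendsto (fun K : ℝ => A * (K ^ 14)⁻¹) atTop (𝓝 (A * 0)) :=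
    (tendsto_inv_atTop_zero.comp (tendsto_pow_atTop (by norm_num : (14 : ℕ) ≠ 0))).const_mul _
  rw [mul_zero] at h
  have h' : Tendsto (fun K : ℝ => Real.exp (A * (K ^ 14)⁻¹)) atTop (𝓝 (Real.exp 0)) :=
    (Real.continuous_exp.tendsto 0).comp h
  rw [Real.exp_zero] at h'
  exact h'.eventually_le_const (by norm_num)

/-- `A K^{-1/4} e^{-(94/100)K¹⁰} ≤ ½ (K¹⁵)⁻¹` for `K` large (`A` fixed; `x¹⁵ e^{-x} → 0` and
`(94/100)K¹⁰ ≥ K` for `K ≥ 2`). [folklore] -/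
theorem eventually_rpow_mul_exp_neg_le_inv_pow (A : ℝ) :
    ∀ᶠ K : ℝ in atTop,
      A * K ^ (-(1 : ℝ) / 4) * Real.exp (-(94 / 100) * K ^ 10) ≤ 1 / 2 * (K ^ 15)⁻¹ := by
  have h : Tendsto (fun K : ℝ => |A| * (K ^ 15 * Real.exp (-K))) atTop (𝓝 (|A| * 0)) :=
    (Real.tendsto_pow_mul_exp_neg_atTop_nhds_zero 15).const_mul _
  rw [mul_zero] at h
  filter_upwards [eventually_ge_atTop 2, h.eventually_le_const (by norm_num : (0 : ℝ) < 1 / 2)]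
    with K hK hle
  have hK0 : 0 < K := by linarith
  have hK1 : 1 ≤ K := by linarith
  have hx : K ^ (-(1 : ℝ) / 4) ≤ 1 := Real.rpow_le_one_of_one_le_of_nonpos hK1 (by norm_num)
  have hx0 : 0 ≤ K ^ (-(1 : ℝ) / 4) := by positivity
  -- `(94/100) K¹⁰ ≥ K`
  have hexp : Real.exp (-(94 / 100) * K ^ 10) ≤ Real.exp (-K) := by
    apply Real.exp_le_exp.2
    have h9 : (2 : ℝ) ^ 9 ≤ K ^ 9 := pow_le_pow_left₀ (by norm_num) hK 9
    have : K ^ 10 = K * K ^ 9 := by ring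
    nlinarith
  have hK15 : 0 < (K ^ 15)⁻¹ := by positivity
  -- multiply the target by `K¹⁵`
  rw [show 1 / 2 * (K ^ 15)⁻¹ = (1 / 2) / K ^ 15 by ring, le_div_iff₀ (by positivity)]
  calc A * K ^ (-(1 : ℝ) / 4) * Real.exp (-(94 / 100) * K ^ 10) * K ^ 15
      ≤ |A| * 1 * Real.exp (-K) * K ^ 15 := by
        have h1 : A * K ^ (-(1 : ℝ) / 4) ≤ |A| * 1 := by
          calc A * K ^ (-(1 : ℝ) / 4) ≤ |A| * K ^ (-(1 : ℝ) / 4) :=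
                mul_le_mul_of_nonneg_right (le_abs_self A) hx0
            _ ≤ |A| * 1 := mul_le_mul_of_nonneg_left hx (abs_nonneg A)
        have h2 : 0 ≤ Real.exp (-(94 / 100) * K ^ 10) * K ^ 15 := by positivity
        have h3 : 0 ≤ |A| * 1 := by positivity
        calc A * K ^ (-(1 : ℝ) / 4) * Real.exp (-(94 / 100) * K ^ 10) * K ^ 15
            = (A * K ^ (-(1 : ℝ) / 4)) * (Real.exp (-(94 / 100) * K ^ 10) * K ^ 15) := by ring
          _ ≤ (|A| * 1) * (Real.exp (-(94 / 100) * K ^ 10) * K ^ 15) :=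
              mul_le_mul_of_nonneg_right h1 h2
          _ ≤ (|A| * 1) * (Real.exp (-K) * K ^ 15) := by
              apply mul_le_mul_of_nonneg_left _ h3
              exact mul_le_mul_of_nonneg_right hexp (by positivity)
          _ = _ := by ring
    _ = |A| * (K ^ 15 * Real.exp (-K)) := by ring
    _ ≤ 1 / 2 := hle

/-- `9 e^{-(94/100)K¹⁰} ≤ e^{-K¹⁰/2}` for `K ≥ 2` (`e^{0.44 K¹⁰} ≥ 1 + 0.44 K¹⁰ ≥ 9`). [folklore] -/
theorem nine_mul_exp_neg_le_exp_neg_half {K : ℝ} (hK : 2 ≤ K) :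
    9 * Real.exp (-(94 / 100) * K ^ 10) ≤ Real.exp (-K ^ 10 / 2) := by
  have hK10 : (1024 : ℝ) ≤ K ^ 10 := by
    calc (1024 : ℝ) = 2 ^ 10 := by norm_num
      _ ≤ K ^ 10 := pow_le_pow_left₀ (by norm_num) hK 10
  have h9 : (9 : ℝ) ≤ Real.exp (44 / 100 * K ^ 10) := by
    have := Real.add_one_le_exp (44 / 100 * K ^ 10)
    linarith
  have e : Real.exp (-K ^ 10 / 2) = Real.exp (44 / 100 * K ^ 10) * Real.exp (-(94 / 100) * K ^ 10) := by
    rw [← Real.exp_add]; congr 1; ring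
  rw [e]
  exact mul_le_mul_of_nonneg_right h9 (Real.exp_pos _).le

/-- `A (1+ε₀)^{-n₀/2} ≤ δ (1+ε₀)^{-n₀/4}` for `n₀` large (`ε₀, δ > 0`). [folklore] -/
theorem eventually_mul_rpow_neg_half_le_mul_rpow_neg_quarter {ε₀ : ℝ} (hε₀ : 0 < ε₀) (A : ℝ)
    {δ : ℝ} (hδ : 0 < δ) :
    ∀ᶠ n₀ : ℤ in atTop,
      A * (1 + ε₀) ^ (-(n₀ : ℝ) / 2) ≤ δ * (1 + ε₀) ^ (-(n₀ : ℝ) / 4) := by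
  have hq0 : (0 : ℝ) < 1 + ε₀ := by linarith
  have h1 : (1 : ℝ) < 1 + ε₀ := by linarith
  have hlim : Tendsto (fun n₀ : ℤ => A * (1 + ε₀) ^ (-(n₀ : ℝ) / 4)) atTop (𝓝 (A * 0)) := by
    refine Tendsto.const_mul A ?_
    have hbot : Tendsto (fun n₀ : ℤ => -(n₀ : ℝ) / 4) atTop atBot := by
      have h2 : Tendsto (fun x : ℝ => -x / 4) atTop atBot := by
        have : (fun x : ℝ => -x / 4) = fun x => (-(1 / 4 : ℝ)) * x := by ext x; ring
        rw [this]
        exact (tendsto_const_mul_atBot_of_neg (by norm_num)).2 tendsto_id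
      exact h2.comp tendsto_intCast_atTop_atTop
    exact (tendsto_rpow_atBot_of_base_gt_one _ h1).comp hbot
  rw [mul_zero] at hlim
  filter_upwards [hlim.eventually_le_const hδ] with n₀ hn
  have hpos : 0 < (1 + ε₀) ^ (-(n₀ : ℝ) / 4) := Real.rpow_pos_of_pos hq0 _
  have e : (1 + ε₀) ^ (-(n₀ : ℝ) / 2) = (1 + ε₀) ^ (-(n₀ : ℝ) / 4) * (1 + ε₀) ^ (-(n₀ : ℝ) / 4) := by
    rw [← Real.rpow_add hq0]; ring_nf
  rw [e, ← mul_assoc]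
  exact mul_le_mul_of_nonneg_right hn hpos.le

end Asymptotics

/-! ## Prop. 6.13, absorbed form, pointwise -/

section Pointwise

variable {γ ε₀ K ε C₁ C₂ C₃ : ℝ} {n₀ N : ℤ} {τ : ℤ → ℝ} {Xr : Fin 4 → ℤ → ℝ → ℝ} {Er : ℤ → ℝ → ℝ}

/-- **Prop. 6.13 in the absorbed form of `SmallScaleOneInput`, pointwise**: under the parameter
inequalities of `prop613_regime` / `prop613_d_one_lt` (with `hKf` split into its `K`- and
`n₀`-halves) and the absorption inequality for (6.118), on a present interval `[0, T]`, `T ≤ 100`,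
with `GoodAt` there and `∫₀ᵀ a₁² ≤ K^{-1/4}`: `|b₁| ≤ 11K^{-1/4}ε`, `|c₁| ≤ K^{-1/4}e^{-K¹⁰/2}ε²`,
`c₁ ≥ -½(1+ε₀)^{-n₀/4}`, `|d₁| < ½K⁻¹⁰`. [cite: Tao2016AveragedNS, §6.6 Prop. 6.13] -/
theorem RescaledHypotheses.smallScaleOne_absorbed
    (h : RescaledHypotheses γ ε₀ K ε C₁ C₂ C₃ n₀ N τ Xr Er) (hε₀ : 0 < ε₀) (hε₀1 : ε₀ < 1)
    (hK : 2 ≤ K) (hε : 0 < ε) (hε1 : ε ≤ 1) (hC₁ : 0 ≤ C₁) (hC₃ : 0 ≤ C₃) (hN : n₀ ≤ N)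
    (hκ : 36 * Real.sqrt 2 * K * ((K ^ 15)⁻¹ * (1 + ε₀) ^ (-(999 : ℝ) / 100) * C₃ *
      geomConst ε₀ ((248 : ℝ) / 100)) ≤ 1)
    (hKa : 12 * ((K ^ 30)⁻¹ * C₃ * geomConst ε₀ ((747 : ℝ) / 100)) ≤ K ^ (-(1 : ℝ) / 4))
    (hKc : 48600 * K ^ 10 * Real.exp (-(188 / 100) * K ^ 10) * K ^ (-(1 : ℝ) / 4) *
      (C₃ * geomConst ε₀ ((741 : ℝ) / 100) + 1) ≤ 1)
    (hKd : K ^ (-(1 : ℝ) / 4) * (3 * C₃ * geomConst ε₀ ((245 : ℝ) / 100) + 1100) < 1 / 100)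
    (hKe : Real.exp (3600 * Real.sqrt 2 * (K ^ 14)⁻¹) ≤ 2)
    (hKf1 : 100 * (54 * Real.sqrt 2) * K ^ (-(1 : ℝ) / 4) * Real.exp (-(94 / 100) * K ^ 10) ≤
      1 / 2 * (K ^ 15)⁻¹)
    (hδ1 : 4 * C₁ * (1 + ε₀) ^ (-(n₀ : ℝ) / 2) *
      (Real.exp 1 * (6 * Real.sqrt 2 * K) * cumEnergyConst ε₀ C₃ * C₃ * geomConst ε₀ ((496 : ℝ) / 100)) ≤
      ε ^ 2 * Real.exp (-K ^ 10) * K ^ (-(1 : ℝ) / 4))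
    (hδ2 : 400 * C₁ * (1 + ε₀) ^ (-(n₀ : ℝ) / 2) ≤ ε ^ 2 * Real.exp (-K ^ 10) * K ^ (-(1 : ℝ) / 4))
    (hδ3 : 400 * C₁ * (1 + ε₀) ^ (-(n₀ : ℝ) / 2) ≤ 1 / 2 * (K ^ 15)⁻¹)
    (hδ4 : Real.exp (6 / 100 * K ^ 10) * (4 * C₁ *
      (Real.exp 1 * (6 * Real.sqrt 2 * K) * cumEnergyConst ε₀ C₃ * C₃ * geomConst ε₀ ((496 : ℝ) / 100) +
        100)) * (1 + ε₀) ^ (-(n₀ : ℝ) / 2) ≤ 1 / 2 * (1 + ε₀) ^ (-(n₀ : ℝ) / 4))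
    {T : ℝ} (hT : T ∈ Icc (0 : ℝ) 100) (hgood : ∀ t ∈ Icc 0 T, GoodAt ε₀ K Xr Er t)
    (hP : ∫ s in (0 : ℝ)..T, Xr 0 1 s ^ 2 ≤ K ^ (-(1 : ℝ) / 4)) {t : ℝ} (ht : t ∈ Icc 0 T) :
    |Xr 1 1 t| ≤ 11 * K ^ (-(1 : ℝ) / 4) * ε ∧
    |Xr 2 1 t| ≤ K ^ (-(1 : ℝ) / 4) * Real.exp (-K ^ 10 / 2) * ε ^ 2 ∧
    -(1 / 2 * (1 + ε₀) ^ (-(n₀ : ℝ) / 4)) ≤ Xr 2 1 t ∧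
    |Xr 3 1 t| < 1 / 2 * (K ^ 10)⁻¹ := by
  have hq1 : (1 : ℝ) ≤ 1 + ε₀ := by linarith
  have hK1 : 1 ≤ K := by linarith
  -- `Ẽ₁ ≤ 1`, `Ẽ₂ ≤ K⁻³⁰` on `[0, T]`
  have hE1 : ∀ s ∈ Icc 0 T, Er 1 s ≤ 1 := fun s hs =>
    h.energy_le_one_of_goodAt hε₀ hε₀1 hK hN hs.1 (hgood s hs) (Or.inr (Or.inr rfl))
  have hE2 : ∀ s ∈ Icc 0 T, Er 2 s ≤ (K ^ 30)⁻¹ := by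
    intro s hs
    have ha := (hgood s hs).after 1 le_rfl
    have e1 : (1 : ℤ) + ((1 : ℕ) : ℤ) = 2 := by norm_num
    rw [e1] at ha
    have hle : (1 + ε₀) ^ (-(10 : ℝ) * ((1 : ℕ) : ℝ)) ≤ 1 :=
      Real.rpow_le_one_of_one_le_of_nonpos hq1 (by norm_num)
    calc Er 2 s ≤ (K ^ 30)⁻¹ * (1 + ε₀) ^ (-(10 : ℝ) * ((1 : ℕ) : ℝ)) := ha
      _ ≤ (K ^ 30)⁻¹ * 1 := mul_le_mul_of_nonneg_left hle (by positivity)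
      _ = (K ^ 30)⁻¹ := mul_one _
  obtain ⟨hb, hc, hcl, -⟩ := h.prop613_regime hε₀ hε₀1 hK1 hε hε1 hC₁ hC₃ hN hκ hKa hKc hKd hδ1 hδ2
    hT.1 hT.2 hE1 hE2 hP ht
  have hKf : 100 * (54 * Real.sqrt 2 * K ^ (-(1 : ℝ) / 4) * Real.exp (-(94 / 100) * K ^ 10) +
      4 * C₁ * (1 + ε₀) ^ (-(n₀ : ℝ) / 2)) ≤ (K ^ 15)⁻¹ := by
    have e : 100 * (54 * Real.sqrt 2 * K ^ (-(1 : ℝ) / 4) * Real.exp (-(94 / 100) * K ^ 10) +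
        4 * C₁ * (1 + ε₀) ^ (-(n₀ : ℝ) / 2)) =
        100 * (54 * Real.sqrt 2) * K ^ (-(1 : ℝ) / 4) * Real.exp (-(94 / 100) * K ^ 10) +
          400 * C₁ * (1 + ε₀) ^ (-(n₀ : ℝ) / 2) := by ring
    rw [e]; linarith
  have hd := h.prop613_d_one_lt hε₀ hε₀1 hK hε hε1 hC₁ hC₃ hN hκ hKa hKc hKd hδ1 hδ2 hKe hKf hT.1 hT.2
    hE1 hE2 hP ht
  refine ⟨hb, ?_, ?_, hd⟩
  · -- `9 K^{-1/4} e^{-(94/100)K¹⁰} ε² ≤ K^{-1/4} e^{-K¹⁰/2} ε²`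
    refine hc.trans ?_
    have h9 := nine_mul_exp_neg_le_exp_neg_half hK
    have h0 : 0 ≤ K ^ (-(1 : ℝ) / 4) * ε ^ 2 := by positivity
    calc 9 * K ^ (-(1 : ℝ) / 4) * Real.exp (-(94 / 100) * K ^ 10) * ε ^ 2
        = (9 * Real.exp (-(94 / 100) * K ^ 10)) * (K ^ (-(1 : ℝ) / 4) * ε ^ 2) := by ring
      _ ≤ Real.exp (-K ^ 10 / 2) * (K ^ (-(1 : ℝ) / 4) * ε ^ 2) := mul_le_mul_of_nonneg_right h9 h0
      _ = K ^ (-(1 : ℝ) / 4) * Real.exp (-K ^ 10 / 2) * ε ^ 2 := by ring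
  · -- absorption of (6.118)
    refine le_trans ?_ hcl
    rw [neg_le_neg_iff]
    calc Real.exp (6 / 100 * K ^ 10) * (4 * C₁ * (1 + ε₀) ^ (-(n₀ : ℝ) / 2) *
          (Real.exp 1 * (6 * Real.sqrt 2 * K) * cumEnergyConst ε₀ C₃ * C₃ *
            geomConst ε₀ ((496 : ℝ) / 100) + 100))
        = Real.exp (6 / 100 * K ^ 10) * (4 * C₁ *
          (Real.exp 1 * (6 * Real.sqrt 2 * K) * cumEnergyConst ε₀ C₃ * C₃ *
            geomConst ε₀ ((496 : ℝ) / 100) + 100)) * (1 + ε₀) ^ (-(n₀ : ℝ) / 2) := by ring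
      _ ≤ 1 / 2 * (1 + ε₀) ^ (-(n₀ : ℝ) / 4) := hδ4

end Pointwise

/-! ## `SmallScaleOneInput` holds -/

/-- **Prop. 6.13 holds in the regime of Prop. 6.5** (corrected coefficient), in the absorbed form
`SmallScaleOneInput`: every parameter inequality of `smallScaleOne_absorbed` holds for `K` large
(depending on `ε₀, C₃`), `ε ≤ 1`, `n₀` large (depending on `ε₀, K, ε, C₁, C₃`).
[cite: Tao2016AveragedNS, §6.6 Prop. 6.13] -/
theorem smallScaleOneInput_holds : SmallScaleOneInput := by
  -- abbreviation for the coefficient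
  have main : ∀ γ : ℝ → ℝ, InRegime γ fun D =>
      ∀ T ∈ Icc (0 : ℝ) 100, (∀ t ∈ Icc 0 T, GoodAt D.ε₀ D.K D.Y D.F t) →
        (∫ t in (0 : ℝ)..T, D.Y 0 1 t ^ 2) ≤ D.K ^ (-(1 : ℝ) / 4) →
          ∀ t ∈ Icc 0 T,
            |D.Y 1 1 t| ≤ 11 * D.K ^ (-(1 : ℝ) / 4) * D.ε ∧
            |D.Y 2 1 t| ≤ D.K ^ (-(1 : ℝ) / 4) * Real.exp (-D.K ^ 10 / 2) * D.ε ^ 2 ∧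
            -(1 / 2 * (1 + D.ε₀) ^ (-(D.n₀ : ℝ) / 4)) ≤ D.Y 2 1 t ∧
            |D.Y 3 1 t| < 1 / 2 * (D.K ^ 10)⁻¹ := by
    intro γ
    -- `K ≥ 2`
    have hK : InRegime γ fun D => 2 ≤ D.K :=
      InRegime.of_K (p := fun _ _ K => 2 ≤ K) fun _ _ _ _ _ => eventually_ge_atTop 2
    -- `ε ≤ 1`
    have hε : InRegime γ fun D => D.ε ≤ 1 := by
      refine InRegime.of_eps (p := fun _ _ _ ε => ε ≤ 1) fun _ _ _ _ _ _ _ => ?_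
      have : Iio (1 : ℝ) ∈ 𝓝[>] (0 : ℝ) := mem_nhdsWithin_of_mem_nhds (Iio_mem_nhds (by norm_num))
      exact Filter.mem_of_superset this fun ε (hε : ε < 1) => (le_of_lt hε : ε ≤ 1)
    -- the six `K`-conditions
    have hκ : InRegime γ fun D => 36 * Real.sqrt 2 * D.K * ((D.K ^ 15)⁻¹ *
        (1 + D.ε₀) ^ (-(999 : ℝ) / 100) * D.C₃ * geomConst D.ε₀ ((248 : ℝ) / 100)) ≤ 1 := by
      refine InRegime.of_K (p := fun ε₀ C₃ K => 36 * Real.sqrt 2 * K * ((K ^ 15)⁻¹ *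
        (1 + ε₀) ^ (-(999 : ℝ) / 100) * C₃ * geomConst ε₀ ((248 : ℝ) / 100)) ≤ 1)
        fun ε₀ C₃ _ _ _ => ?_
      have := eventually_mul_K_mul_inv_pow_fifteen_le (36 * Real.sqrt 2)
        ((1 + ε₀) ^ (-(999 : ℝ) / 100) * C₃ * geomConst ε₀ ((248 : ℝ) / 100))
      filter_upwards [this] with K hK
      calc 36 * Real.sqrt 2 * K * ((K ^ 15)⁻¹ * (1 + ε₀) ^ (-(999 : ℝ) / 100) * C₃ *
            geomConst ε₀ ((248 : ℝ) / 100))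
          = 36 * Real.sqrt 2 * K * ((K ^ 15)⁻¹ * ((1 + ε₀) ^ (-(999 : ℝ) / 100) * C₃ *
            geomConst ε₀ ((248 : ℝ) / 100))) := by ring
        _ ≤ 1 := hK
    have hKa : InRegime γ fun D => 12 * ((D.K ^ 30)⁻¹ * D.C₃ * geomConst D.ε₀ ((747 : ℝ) / 100)) ≤
        D.K ^ (-(1 : ℝ) / 4) := by
      refine InRegime.of_K (p := fun ε₀ C₃ K => 12 * ((K ^ 30)⁻¹ * C₃ * geomConst ε₀ ((747 : ℝ) / 100)) ≤
        K ^ (-(1 : ℝ) / 4)) fun ε₀ C₃ _ _ _ => ?_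
      filter_upwards [eventually_mul_inv_pow_thirty_le_rpow (12 * (C₃ * geomConst ε₀ ((747 : ℝ) / 100)))]
        with K hK
      calc 12 * ((K ^ 30)⁻¹ * C₃ * geomConst ε₀ ((747 : ℝ) / 100))
          = 12 * (C₃ * geomConst ε₀ ((747 : ℝ) / 100)) * (K ^ 30)⁻¹ := by ring
        _ ≤ K ^ (-(1 : ℝ) / 4) := hK
    have hKc : InRegime γ fun D => 48600 * D.K ^ 10 * Real.exp (-(188 / 100) * D.K ^ 10) *
        D.K ^ (-(1 : ℝ) / 4) * (D.C₃ * geomConst D.ε₀ ((741 : ℝ) / 100) + 1) ≤ 1 := by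
      refine InRegime.of_K (p := fun ε₀ C₃ K => 48600 * K ^ 10 * Real.exp (-(188 / 100) * K ^ 10) *
        K ^ (-(1 : ℝ) / 4) * (C₃ * geomConst ε₀ ((741 : ℝ) / 100) + 1) ≤ 1) fun ε₀ C₃ _ _ _ => ?_
      filter_upwards [eventually_pow_ten_mul_exp_neg_le (48600 * (C₃ * geomConst ε₀ ((741 : ℝ) / 100) + 1))]
        with K hK
      calc 48600 * K ^ 10 * Real.exp (-(188 / 100) * K ^ 10) * K ^ (-(1 : ℝ) / 4) *
            (C₃ * geomConst ε₀ ((741 : ℝ) / 100) + 1)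
          = 48600 * (C₃ * geomConst ε₀ ((741 : ℝ) / 100) + 1) * K ^ 10 *
            Real.exp (-(188 / 100) * K ^ 10) * K ^ (-(1 : ℝ) / 4) := by ring
        _ ≤ 1 := hK
    have hKd : InRegime γ fun D => D.K ^ (-(1 : ℝ) / 4) *
        (3 * D.C₃ * geomConst D.ε₀ ((245 : ℝ) / 100) + 1100) < 1 / 100 :=
      InRegime.of_K (p := fun ε₀ C₃ K => K ^ (-(1 : ℝ) / 4) *
        (3 * C₃ * geomConst ε₀ ((245 : ℝ) / 100) + 1100) < 1 / 100) fun ε₀ C₃ _ _ _ =>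
        eventually_rpow_neg_quarter_mul_lt _
    have hKe : InRegime γ fun D => Real.exp (3600 * Real.sqrt 2 * (D.K ^ 14)⁻¹) ≤ 2 :=
      InRegime.of_K (p := fun _ _ K => Real.exp (3600 * Real.sqrt 2 * (K ^ 14)⁻¹) ≤ 2)
        fun _ _ _ _ _ => eventually_exp_mul_inv_pow_le_two _
    have hKf1 : InRegime γ fun D => 100 * (54 * Real.sqrt 2) * D.K ^ (-(1 : ℝ) / 4) *
        Real.exp (-(94 / 100) * D.K ^ 10) ≤ 1 / 2 * (D.K ^ 15)⁻¹ :=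
      InRegime.of_K (p := fun _ _ K => 100 * (54 * Real.sqrt 2) * K ^ (-(1 : ℝ) / 4) *
        Real.exp (-(94 / 100) * K ^ 10) ≤ 1 / 2 * (K ^ 15)⁻¹)
        fun _ _ _ _ _ => eventually_rpow_mul_exp_neg_le_inv_pow _
    -- the four `n₀`-conditions
    have hδ1 : InRegime γ fun D => 4 * D.C₁ * (1 + D.ε₀) ^ (-(D.n₀ : ℝ) / 2) *
        (Real.exp 1 * (6 * Real.sqrt 2 * D.K) * cumEnergyConst D.ε₀ D.C₃ * D.C₃ *
          geomConst D.ε₀ ((496 : ℝ) / 100)) ≤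
        D.ε ^ 2 * Real.exp (-D.K ^ 10) * D.K ^ (-(1 : ℝ) / 4) := by
      refine InRegime.of_n0 (p := fun ε₀ K ε C₁ _ C₃ n₀ => 4 * C₁ * (1 + ε₀) ^ (-(n₀ : ℝ) / 2) *
        (Real.exp 1 * (6 * Real.sqrt 2 * K) * cumEnergyConst ε₀ C₃ * C₃ * geomConst ε₀ ((496 : ℝ) / 100)) ≤
        ε ^ 2 * Real.exp (-K ^ 10) * K ^ (-(1 : ℝ) / 4))
        fun ε₀ K ε C₁ C₂ C₃ hε₀ _ hK hε _ _ _ => ?_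
      have hpos : 0 < ε ^ 2 * Real.exp (-K ^ 10) * K ^ (-(1 : ℝ) / 4) := by positivity
      filter_upwards [eventually_mul_rpow_neg_half_le hε₀
        (4 * C₁ * (Real.exp 1 * (6 * Real.sqrt 2 * K) * cumEnergyConst ε₀ C₃ * C₃ *
          geomConst ε₀ ((496 : ℝ) / 100))) hpos] with n₀ hn
      calc 4 * C₁ * (1 + ε₀) ^ (-(n₀ : ℝ) / 2) *
            (Real.exp 1 * (6 * Real.sqrt 2 * K) * cumEnergyConst ε₀ C₃ * C₃ * geomConst ε₀ ((496 : ℝ) / 100))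
          = 4 * C₁ * (Real.exp 1 * (6 * Real.sqrt 2 * K) * cumEnergyConst ε₀ C₃ * C₃ *
            geomConst ε₀ ((496 : ℝ) / 100)) * (1 + ε₀) ^ (-(n₀ : ℝ) / 2) := by ring
        _ ≤ _ := hn
    have hδ2 : InRegime γ fun D => 400 * D.C₁ * (1 + D.ε₀) ^ (-(D.n₀ : ℝ) / 2) ≤
        D.ε ^ 2 * Real.exp (-D.K ^ 10) * D.K ^ (-(1 : ℝ) / 4) := by
      refine InRegime.of_n0 (p := fun ε₀ K ε C₁ _ _ n₀ => 400 * C₁ * (1 + ε₀) ^ (-(n₀ : ℝ) / 2) ≤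
        ε ^ 2 * Real.exp (-K ^ 10) * K ^ (-(1 : ℝ) / 4)) fun ε₀ K ε C₁ _ _ hε₀ _ hK hε _ _ _ => ?_
      have hpos : 0 < ε ^ 2 * Real.exp (-K ^ 10) * K ^ (-(1 : ℝ) / 4) := by positivity
      exact eventually_mul_rpow_neg_half_le hε₀ _ hpos
    have hδ3 : InRegime γ fun D => 400 * D.C₁ * (1 + D.ε₀) ^ (-(D.n₀ : ℝ) / 2) ≤
        1 / 2 * (D.K ^ 15)⁻¹ := by
      refine InRegime.of_n0 (p := fun ε₀ K _ C₁ _ _ n₀ => 400 * C₁ * (1 + ε₀) ^ (-(n₀ : ℝ) / 2) ≤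
        1 / 2 * (K ^ 15)⁻¹) fun ε₀ K _ C₁ _ _ hε₀ _ hK _ _ _ _ => ?_
      have hpos : 0 < 1 / 2 * (K ^ 15)⁻¹ := by positivity
      exact eventually_mul_rpow_neg_half_le hε₀ _ hpos
    have hδ4 : InRegime γ fun D => Real.exp (6 / 100 * D.K ^ 10) * (4 * D.C₁ *
        (Real.exp 1 * (6 * Real.sqrt 2 * D.K) * cumEnergyConst D.ε₀ D.C₃ * D.C₃ *
          geomConst D.ε₀ ((496 : ℝ) / 100) + 100)) * (1 + D.ε₀) ^ (-(D.n₀ : ℝ) / 2) ≤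
        1 / 2 * (1 + D.ε₀) ^ (-(D.n₀ : ℝ) / 4) :=
      InRegime.of_n0 (p := fun ε₀ K _ C₁ _ C₃ n₀ => Real.exp (6 / 100 * K ^ 10) * (4 * C₁ *
        (Real.exp 1 * (6 * Real.sqrt 2 * K) * cumEnergyConst ε₀ C₃ * C₃ *
          geomConst ε₀ ((496 : ℝ) / 100) + 100)) * (1 + ε₀) ^ (-(n₀ : ℝ) / 2) ≤
        1 / 2 * (1 + ε₀) ^ (-(n₀ : ℝ) / 4))
        fun ε₀ _ _ _ _ _ hε₀ _ _ _ _ _ _ =>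
          eventually_mul_rpow_neg_half_le_mul_rpow_neg_quarter hε₀ _ (by norm_num)
    -- assemble
    refine (((((((((((hK.and hε).and hκ).and hKa).and hKc).and hKd).and hKe).and hKf1).and hδ1).and
      hδ2).and hδ3).and hδ4).mono ?_
    rintro D hD ⟨⟨⟨⟨⟨⟨⟨⟨⟨⟨⟨hKD, hεD⟩, hκD⟩, hKaD⟩, hKcD⟩, hKdD⟩, hKeD⟩, hKf1D⟩, hδ1D⟩, hδ2D⟩, hδ3D⟩,
      hδ4D⟩ T hT hgood hP t ht
    exact hD.hyp.smallScaleOne_absorbed hD.ε₀_pos hD.ε₀_lt_one hKD hD.ε_pos hεD hD.C₁_nonneg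
      hD.C₃_nonneg hD.n₀_le_N hκD hKaD hKcD hKdD hKeD hKf1D hδ1D hδ2D hδ3D hδ4D hT hgood hP ht
  exact main _

/-- **The corrected Prop. 6.5 from Prop. 6.15 alone** (Prop. 6.13 being now discharged):
`ReducedClaimIIInput → rescaledStepCorrected'`. [cite: Tao2016AveragedNS, §6.6] -/
theorem rescaledStepCorrected'_of_reducedClaimIIInput (h15 : ReducedClaimIIInput) :
    rescaledStepCorrected' :=
  rescaledStepCorrected'_of_inputs smallScaleOneInput_holds h15

end TaoCascade

end Literature.Analysis.FluidPDE
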